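/-
Copyright (c) 2026. Released under Apache 2.0 license.
-/
import Literature.NumberTheory.Automorphic.UnboundedDenominatorsInvariantHomRealization
import Literature.NumberTheory.Automorphic.UnboundedDenominatorsInvariantHomCrossCommutator
import HarnessLib

/-!
# The invariant form of CDT Cor. 4.5.3: relative transfer and gluing over coprime factors of the level

For an `SL₂(ℤ)`-invariant `θ : Γ(N) → Q` with kernel `K_θ ≤ SL₂(ℤ)` (`UnboundedDenominatorsInvariantHomRealization`),
say that a subgroup `X ≥ Γ(N)` satisfies the LOCAL CONDITION if `θ` kills `Γ(N) ∩ ([X, X]·K_θ)` — in the central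
extension `SL₂(ℤ)/K_θ`, the commutator subgroup of the image of `X` meets the centre `Z = image of Γ(N)` trivially.
The local condition for `X = SL₂(ℤ)` gives the conclusion of the invariant form with `M = 12N`
(`map_eq_one_of_mem_Gamma_mul_of_commutator`).  This file provides the two devices that propagate local conditions:

* `local_of_local_of_relIndex_coprime` — **relative transfer**: if `Γ(N) ≤ H ≤ H'` with `[H' : H]` prime to an
  exponent of `θ`, the local condition for `H` implies that for `H'` (transfer `H̄' → H̄ᵃᵇ` on the central element);
* `local_Gamma_of_local_Gamma_mul` — **gluing**: for a level `B·A₁·A₂` with `gcd(B A₁, A₂) = 1`, the local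
  conditions for `Γ(B A₁)` and `Γ(B A₂)` imply that for `Γ(B)`: the images of `Γ(B A₁)` and `Γ(B A₂)` commute
  (`map_commutatorElement_eq_one`) and generate the image of `Γ(B)` (strong approximation), so the commutator
  subgroups multiply.

Together with the local certificates (cyclic subgroups, dicyclic normalisers) these reduce the invariant form of
[CalegariDimitrovTang2025, Cor. 4.5.3] for a level `N` to prime-power levels; see the crux memo of K★ (`cdt_thm1`).
-/

open scoped MatrixGroups commutatorElement

namespace Literature.NumberTheory.Automorphic

namespace UnboundedDenominators

open CongruenceSubgroup Matrix.SpecialLinearGroup ModularGroup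
open Literature.GroupTheory.ArithmeticGroups.IharaAmalgam (exists_mem_Gamma_forall_dvd_sub)

variable {N : ℕ} {Q : Type*} [CommGroup Q]

/-- `⁅H, H⁆ ≤ H`. [folklore] -/
private theorem commutator_le_self {G : Type*} [Group G] (H : Subgroup G) : ⁅H, H⁆ ≤ H := by
  rw [Subgroup.commutator_def, Subgroup.closure_le]
  rintro _ ⟨a, ha, b, hb, rfl⟩
  rw [SetLike.mem_coe, commutatorElement_def]
  exact mul_mem (mul_mem (mul_mem ha hb) (inv_mem ha)) (inv_mem hb)

/-- `[a₁ a₂, b₁ b₂] = [a₁, b₁] [a₂, b₂]` when `a₁, b₁ ∈ H₁`, `a₂, b₂ ∈ H₂` and `H₁`, `H₂` commute elementwise. [folklore] -/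
private theorem commutatorElement_mul_mul_of_comm {G : Type*} [Group G] {H₁ H₂ : Subgroup G}
    (hc : ∀ a ∈ H₁, ∀ b ∈ H₂, a * b = b * a) {a₁ b₁ a₂ b₂ : G} (ha₁ : a₁ ∈ H₁) (hb₁ : b₁ ∈ H₁)
    (ha₂ : a₂ ∈ H₂) (hb₂ : b₂ ∈ H₂) : ⁅a₁ * a₂, b₁ * b₂⁆ = ⁅a₁, b₁⁆ * ⁅a₂, b₂⁆ := by
  have h1 : a₂ * b₁ = b₁ * a₂ := (hc b₁ hb₁ a₂ ha₂).symm
  have h2 : a₂⁻¹ * a₁⁻¹ = a₁⁻¹ * a₂⁻¹ := (hc a₁⁻¹ (inv_mem ha₁) a₂⁻¹ (inv_mem ha₂)).symm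
  have h3 : b₂ * a₁⁻¹ = a₁⁻¹ * b₂ := (hc a₁⁻¹ (inv_mem ha₁) b₂ hb₂).symm
  have h4 : a₂ * a₁⁻¹ = a₁⁻¹ * a₂ := (hc a₁⁻¹ (inv_mem ha₁) a₂ ha₂).symm
  have h5 : b₂⁻¹ * b₁⁻¹ = b₁⁻¹ * b₂⁻¹ := (hc b₁⁻¹ (inv_mem hb₁) b₂⁻¹ (inv_mem hb₂)).symm
  have h6 : a₂ * b₁⁻¹ = b₁⁻¹ * a₂ := (hc b₁⁻¹ (inv_mem hb₁) a₂ ha₂).symm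
  have h7 : b₂ * b₁⁻¹ = b₁⁻¹ * b₂ := (hc b₁⁻¹ (inv_mem hb₁) b₂ hb₂).symm
  have h8 : a₂⁻¹ * b₁⁻¹ = b₁⁻¹ * a₂⁻¹ := (hc b₁⁻¹ (inv_mem hb₁) a₂⁻¹ (inv_mem ha₂)).symm
  simp only [commutatorElement_def, mul_inv_rev]
  -- `a₁ a₂ b₁ b₂ a₂⁻¹ a₁⁻¹ b₂⁻¹ b₁⁻¹ = a₁ b₁ a₁⁻¹ b₁⁻¹ · a₂ b₂ a₂⁻¹ b₂⁻¹`
  calc a₁ * a₂ * (b₁ * b₂) * (a₂⁻¹ * a₁⁻¹) * (b₂⁻¹ * b₁⁻¹)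
      = a₁ * (a₂ * b₁) * b₂ * (a₂⁻¹ * a₁⁻¹) * (b₂⁻¹ * b₁⁻¹) := by group
    _ = a₁ * (b₁ * a₂) * b₂ * (a₁⁻¹ * a₂⁻¹) * (b₁⁻¹ * b₂⁻¹) := by rw [h1, h2, h5]
    _ = a₁ * b₁ * a₂ * (b₂ * a₁⁻¹) * a₂⁻¹ * b₁⁻¹ * b₂⁻¹ := by group
    _ = a₁ * b₁ * a₂ * (a₁⁻¹ * b₂) * a₂⁻¹ * b₁⁻¹ * b₂⁻¹ := by rw [h3]
    _ = a₁ * b₁ * (a₂ * a₁⁻¹) * b₂ * a₂⁻¹ * b₁⁻¹ * b₂⁻¹ := by group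
    _ = a₁ * b₁ * (a₁⁻¹ * a₂) * b₂ * a₂⁻¹ * b₁⁻¹ * b₂⁻¹ := by rw [h4]
    _ = a₁ * b₁ * a₁⁻¹ * a₂ * b₂ * (a₂⁻¹ * b₁⁻¹) * b₂⁻¹ := by group
    _ = a₁ * b₁ * a₁⁻¹ * a₂ * b₂ * (b₁⁻¹ * a₂⁻¹) * b₂⁻¹ := by rw [h8]
    _ = a₁ * b₁ * a₁⁻¹ * a₂ * (b₂ * b₁⁻¹) * a₂⁻¹ * b₂⁻¹ := by group
    _ = a₁ * b₁ * a₁⁻¹ * a₂ * (b₁⁻¹ * b₂) * a₂⁻¹ * b₂⁻¹ := by rw [h7]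
    _ = a₁ * b₁ * a₁⁻¹ * (a₂ * b₁⁻¹) * b₂ * a₂⁻¹ * b₂⁻¹ := by group
    _ = a₁ * b₁ * a₁⁻¹ * (b₁⁻¹ * a₂) * b₂ * a₂⁻¹ * b₂⁻¹ := by rw [h6]
    _ = a₁ * b₁ * a₁⁻¹ * b₁⁻¹ * (a₂ * b₂ * a₂⁻¹ * b₂⁻¹) := by group

/-! ### Relative transfer -/

/-- **Relative transfer.** Let `θ : Γ(N) → Q` be `SL₂(ℤ)`-invariant with `θ(x)^e = 1` for all `x`, and let
`Γ(N) ≤ H ≤ H'` with `[H' : H]` finite and prime to `e`.  If `θ` kills `Γ(N) ∩ ([H, H]·K_θ)` then it kills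
`Γ(N) ∩ ([H', H']·K_θ)`: the transfer from the image `H̄'` of `H'` in `SL₂(ℤ)/K_θ` to `H̄ᵃᵇ` sends a central `z ∈ [H̄', H̄']`
to `z^{[H':H]} ∈ [H̄, H̄]`. [cite: Rotman1995, Theorem 7.47] -/
theorem local_of_local_of_relIndex_coprime (θ : Gamma N →* Q)
    (hθ : ∀ (g x : SL(2, ℤ)) (hx : x ∈ Gamma N) (hgx : g * x * g⁻¹ ∈ Gamma N),
      θ ⟨g * x * g⁻¹, hgx⟩ = θ ⟨x, hx⟩)
    (H H' : Subgroup SL(2, ℤ)) (hNH : Gamma N ≤ H) (hHH' : H ≤ H') {e : ℕ} (he : ∀ x : Gamma N, θ x ^ e = 1)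
    (hidx : H.relIndex H' ≠ 0) (hcop : e.Coprime (H.relIndex H'))
    (loc : ∀ (y : SL(2, ℤ)) (hy : y ∈ Gamma N), y ∈ ⁅H, H⁆ ⊔ θ.ker.map (Gamma N).subtype → θ ⟨y, hy⟩ = 1) :
    ∀ (y : SL(2, ℤ)) (hy : y ∈ Gamma N), y ∈ ⁅H', H'⁆ ⊔ θ.ker.map (Gamma N).subtype → θ ⟨y, hy⟩ = 1 := by
  intro y hy hyc
  set K : Subgroup SL(2, ℤ) := θ.ker.map (Gamma N).subtype with hKdef
  haveI : K.Normal := ker_map_subtype_normal θ hθ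
  set π : SL(2, ℤ) →* SL(2, ℤ) ⧸ K := QuotientGroup.mk' K with hπ
  -- the ambient group `G' = H̄'` and its subgroup `A = H̄`
  set G' : Subgroup (SL(2, ℤ) ⧸ K) := H'.map π with hG'
  set A : Subgroup G' := (H.map π).subgroupOf G' with hA
  have hAidx : A.index = H.relIndex H' := by
    rw [hA, ← Subgroup.relIndex, hG']
    have h := Subgroup.relIndex_comap (H := H.map π) π H'
    rw [Subgroup.comap_map_eq, QuotientGroup.ker_mk',
      sup_eq_left.mpr ((ker_map_subtype_le θ).trans hNH)] at h
    exact h.symm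
  haveI : A.FiniteIndex := ⟨by rw [hAidx]; exact hidx⟩
  have hyH' : π y ∈ G' := Subgroup.mem_map_of_mem π (hHH' (hNH hy))
  set ζ : G' := ⟨π y, hyH'⟩ with hζ
  have hζA : ζ ∈ A := by
    rw [hA, Subgroup.mem_subgroupOf]
    exact Subgroup.mem_map_of_mem π (hNH hy)
  have hζc : ζ ∈ Subgroup.center G' := by
    rw [Subgroup.mem_center_iff]
    intro g
    apply Subtype.ext
    exact Subgroup.mem_center_iff.mp (mk_mem_center_of_mem_Gamma θ hθ hy) g
  -- `ζ ∈ [G', G']`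
  have hζcomm : ζ ∈ commutator G' := by
    have h1 : π y ∈ ⁅G', G'⁆ := by
      rw [hG', ← Subgroup.map_commutator]
      have h3 : y ∈ ⁅H', H'⁆ ⊔ K := hyc
      rw [Subgroup.mem_sup_of_normal_right] at h3
      obtain ⟨u, hu, v, hv, rfl⟩ := h3
      refine ⟨u, hu, ?_⟩
      have hv1 : π v = 1 := by
        rw [hπ, QuotientGroup.mk'_apply]
        exact (QuotientGroup.eq_one_iff v).mpr hv
      rw [map_mul, hv1, mul_one]
    have h2 : ⁅G', G'⁆ = (commutator G').map G'.subtype := by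
      rw [commutator_def, Subgroup.map_commutator, ← MonoidHom.range_eq_map, Subgroup.range_subtype]
    rw [h2] at h1
    obtain ⟨c, hc, hcy⟩ := h1
    have : c = ζ := Subtype.ext hcy
    rwa [this] at hc
  -- transfer inside `G'`
  have ht := pow_index_mem_commutator_of_mem_center A hζA hζc hζcomm
  -- push back to `SL₂(ℤ)/K_θ`: `(π y)^{[H':H]} ∈ [H̄, H̄]`
  have hmap : (π y) ^ A.index ∈ ⁅H.map π, H.map π⁆ := by
    have h1 : (π y) ^ A.index ∈ ((commutator A).map A.subtype).map G'.subtype :=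
      ⟨_, ⟨_, ht, rfl⟩, by simp [hζ]⟩
    have hS : ((commutator A).map A.subtype).map G'.subtype = ⁅H.map π, H.map π⁆ := by
      rw [commutator_def, Subgroup.map_commutator, ← MonoidHom.range_eq_map, Subgroup.range_subtype,
        Subgroup.map_commutator, hA, Subgroup.map_subgroupOf_eq_of_le (Subgroup.map_mono hHH')]
    rwa [hS] at h1
  rw [← Subgroup.map_commutator, ← map_pow] at hmap
  obtain ⟨c, hc, hcy⟩ := hmap
  have hyn : y ^ A.index ∈ ⁅H, H⁆ ⊔ K := by
    rw [Subgroup.mem_sup_of_normal_right]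
    refine ⟨c, hc, c⁻¹ * y ^ A.index, ?_, by group⟩
    rw [← QuotientGroup.eq, ← QuotientGroup.mk'_apply, ← QuotientGroup.mk'_apply, ← hπ, hcy]
  have hθn : θ ⟨y, hy⟩ ^ A.index = 1 := by
    have := loc (y ^ A.index) (Subgroup.pow_mem _ hy _) hyn
    rwa [← map_pow]
  have h3 : orderOf (θ ⟨y, hy⟩) ∣ Nat.gcd e (H.relIndex H') :=
    Nat.dvd_gcd (orderOf_dvd_of_pow_eq_one (he ⟨y, hy⟩)) (orderOf_dvd_of_pow_eq_one (hAidx ▸ hθn))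
  rw [Nat.Coprime.gcd_eq_one hcop, Nat.dvd_one] at h3
  exact orderOf_eq_one_iff.mp h3

/-! ### Gluing over coprime factors -/

/-- `Γ(L) ≤ Γ(M)` for `M ∣ L`. [folklore] -/
private theorem Gamma_le_Gamma_of_dvd'' {M L : ℕ} (h : M ∣ L) : Gamma L ≤ Gamma M := by
  intro γ hγ
  obtain ⟨h00, h01, h10, h11⟩ := Gamma_mem.mp hγ
  have cast_eq : ∀ a : ℤ, ((a : ZMod L).cast : ZMod M) = (a : ZMod M) := fun a ↦
    ZMod.cast_intCast h a
  rw [Gamma_mem]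
  refine ⟨?_, ?_, ?_, ?_⟩
  · rw [← cast_eq, h00, ZMod.cast_one h]
  · rw [← cast_eq, h01, ZMod.cast_zero]
  · rw [← cast_eq, h10, ZMod.cast_zero]
  · rw [← cast_eq, h11, ZMod.cast_one h]

/-- **Strong approximation, relative form**: `Γ(B) = Γ(B A₁) · Γ(B A₂)` when `gcd(B A₁, A₂) = 1`.
[cite: Serre1980Trees, II.1.4 Cor. 1] -/
theorem exists_mem_Gamma_mul_mul_eq {B A₁ A₂ : ℕ} (hcop : (B * A₁).Coprime A₂) {g : SL(2, ℤ)}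
    (hg : g ∈ Gamma B) : ∃ γ δ : SL(2, ℤ), γ ∈ Gamma (B * A₁) ∧ δ ∈ Gamma (B * A₂) ∧ g = γ * δ := by
  obtain ⟨γ, hγ, h⟩ := exists_mem_Gamma_forall_dvd_sub hcop g
  have hδ₂ : γ⁻¹ * g ∈ Gamma A₂ := inv_mul_mem_Gamma_of_forall_dvd_sub h
  have hδB : γ⁻¹ * g ∈ Gamma B :=
    mul_mem (inv_mem (Gamma_le_Gamma_of_dvd'' (dvd_mul_right B A₁) hγ)) hg
  refine ⟨γ, γ⁻¹ * g, hγ, ?_, by group⟩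
  exact mem_Gamma_mul_of_coprime (Nat.Coprime.coprime_dvd_left (dvd_mul_right B A₁) hcop) hδB hδ₂

/-- **Gluing over coprime factors of the level.**  Let `θ : Γ(B A₁ A₂) → Q` be `SL₂(ℤ)`-invariant with
`gcd(B A₁, A₂) = 1`.  If `θ` kills `Γ(N) ∩ ([Γ(B A₁), Γ(B A₁)]·K_θ)` and `Γ(N) ∩ ([Γ(B A₂), Γ(B A₂)]·K_θ)`, then it kills
`Γ(N) ∩ ([Γ(B), Γ(B)]·K_θ)`: in `SL₂(ℤ)/K_θ` the images of `Γ(B A₁)` and `Γ(B A₂)` commute elementwise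
(`map_commutatorElement_eq_one`) and generate the image of `Γ(B)`, so `[Γ̄(B), Γ̄(B)] = [Γ̄(B A₁), Γ̄(B A₁)]·[Γ̄(B A₂), Γ̄(B A₂)]`
and an element of the centre splits into two central factors. [cite: CalegariDimitrovTang2025, Corollary 4.5.3] -/
theorem local_Gamma_of_local_Gamma_mul {B A₁ A₂ : ℕ} (hcop : (B * A₁).Coprime A₂)
    (θ : Gamma (B * A₁ * A₂) →* Q)
    (hθ : ∀ (g x : SL(2, ℤ)) (hx : x ∈ Gamma (B * A₁ * A₂)) (hgx : g * x * g⁻¹ ∈ Gamma (B * A₁ * A₂)),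
      θ ⟨g * x * g⁻¹, hgx⟩ = θ ⟨x, hx⟩)
    (loc₁ : ∀ (y : SL(2, ℤ)) (hy : y ∈ Gamma (B * A₁ * A₂)),
      y ∈ ⁅Gamma (B * A₁), Gamma (B * A₁)⁆ ⊔ θ.ker.map (Gamma (B * A₁ * A₂)).subtype → θ ⟨y, hy⟩ = 1)
    (loc₂ : ∀ (y : SL(2, ℤ)) (hy : y ∈ Gamma (B * A₁ * A₂)),
      y ∈ ⁅Gamma (B * A₂), Gamma (B * A₂)⁆ ⊔ θ.ker.map (Gamma (B * A₁ * A₂)).subtype → θ ⟨y, hy⟩ = 1) :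
    ∀ (y : SL(2, ℤ)) (hy : y ∈ Gamma (B * A₁ * A₂)),
      y ∈ ⁅Gamma B, Gamma B⁆ ⊔ θ.ker.map (Gamma (B * A₁ * A₂)).subtype → θ ⟨y, hy⟩ = 1 := by
  set K : Subgroup SL(2, ℤ) := θ.ker.map (Gamma (B * A₁ * A₂)).subtype with hKdef
  haveI : K.Normal := ker_map_subtype_normal θ hθ
  set π : SL(2, ℤ) →* SL(2, ℤ) ⧸ K := QuotientGroup.mk' K with hπ
  set G₁ : Subgroup (SL(2, ℤ) ⧸ K) := (Gamma (B * A₁)).map π with hG₁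
  set G₂ : Subgroup (SL(2, ℤ) ⧸ K) := (Gamma (B * A₂)).map π with hG₂
  have hN₁ : Gamma (B * A₁ * A₂) ≤ Gamma (B * A₁) := Gamma_le_Gamma_of_dvd'' (dvd_mul_right _ A₂)
  have hN₂ : Gamma (B * A₁ * A₂) ≤ Gamma (B * A₂) := Gamma_le_Gamma_of_dvd'' ⟨A₁, by ring⟩
  have hKer : ∀ v : SL(2, ℤ), v ∈ K → π v = 1 := fun v hv ↦ by
    rw [hπ, QuotientGroup.mk'_apply]; exact (QuotientGroup.eq_one_iff v).mpr hv
  -- (a) the two images commute elementwise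
  have hcomm : ∀ a ∈ G₁, ∀ b ∈ G₂, a * b = b * a := by
    rintro _ ⟨x, hx, rfl⟩ _ ⟨y, hy, rfl⟩
    have hy' : y ∈ Gamma A₂ := Gamma_le_Gamma_of_dvd'' (dvd_mul_left A₂ B) hy
    have h1 := map_commutatorElement_eq_one hcop θ hθ hx hy'
    have hk : ⁅x, y⁆ ∈ K := (mem_ker_map_subtype_iff θ).mpr ⟨_, h1⟩
    have h2 := hKer _ hk
    rw [commutatorElement_def, map_mul, map_mul, map_mul, map_inv, map_inv,
      mul_inv_eq_one, mul_inv_eq_iff_eq_mul] at h2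
    exact h2
  -- (b) intersections
  have hinter : ∀ g : SL(2, ℤ), g ∈ Gamma (B * A₁) → g ∈ Gamma (B * A₂) → g ∈ Gamma (B * A₁ * A₂) := by
    intro g h1 h2
    exact mem_Gamma_mul_of_coprime hcop h1 (Gamma_le_Gamma_of_dvd'' (dvd_mul_left A₂ B) h2)
  -- (c) every commutator of the image of `Γ(B)` splits as `d₁ d₂`
  have hsplit : ∀ w ∈ ⁅(Gamma B).map π, (Gamma B).map π⁆,
      ∃ d₁ ∈ ⁅G₁, G₁⁆, ∃ d₂ ∈ ⁅G₂, G₂⁆, w = d₁ * d₂ := by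
    intro w hw
    rw [Subgroup.commutator_def] at hw
    refine Subgroup.closure_induction (p := fun w _ ↦ ∃ d₁ ∈ ⁅G₁, G₁⁆, ∃ d₂ ∈ ⁅G₂, G₂⁆, w = d₁ * d₂)
      ?_ ?_ ?_ ?_ hw
    · rintro _ ⟨a, ha, b, hb, rfl⟩
      obtain ⟨ga, hga, rfl⟩ := ha
      obtain ⟨gb, hgb, rfl⟩ := hb
      obtain ⟨γa, δa, hγa, hδa, rfl⟩ := exists_mem_Gamma_mul_mul_eq hcop hga
      obtain ⟨γb, δb, hγb, hδb, rfl⟩ := exists_mem_Gamma_mul_mul_eq hcop hgb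
      refine ⟨⁅π γa, π γb⁆, Subgroup.commutator_mem_commutator ⟨γa, hγa, rfl⟩ ⟨γb, hγb, rfl⟩,
        ⁅π δa, π δb⁆, Subgroup.commutator_mem_commutator ⟨δa, hδa, rfl⟩ ⟨δb, hδb, rfl⟩, ?_⟩
      rw [map_mul, map_mul]
      exact commutatorElement_mul_mul_of_comm hcomm ⟨γa, hγa, rfl⟩ ⟨γb, hγb, rfl⟩ ⟨δa, hδa, rfl⟩
        ⟨δb, hδb, rfl⟩
    · exact ⟨1, one_mem _, 1, one_mem _, by rw [mul_one]⟩
    · rintro u v _ _ ⟨d₁, hd₁, d₂, hd₂, rfl⟩ ⟨d₁', hd₁', d₂', hd₂', rfl⟩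
      refine ⟨d₁ * d₁', mul_mem hd₁ hd₁', d₂ * d₂', mul_mem hd₂ hd₂', ?_⟩
      have h := hcomm d₁' (commutator_le_self _ hd₁') d₂ (commutator_le_self _ hd₂)
      calc d₁ * d₂ * (d₁' * d₂') = d₁ * (d₂ * d₁') * d₂' := by group
        _ = d₁ * (d₁' * d₂) * d₂' := by rw [h]
        _ = d₁ * d₁' * (d₂ * d₂') := by group
    · rintro u _ ⟨d₁, hd₁, d₂, hd₂, rfl⟩
      refine ⟨d₁⁻¹, inv_mem hd₁, d₂⁻¹, inv_mem hd₂, ?_⟩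
      have h := hcomm d₁⁻¹ (commutator_le_self _ (inv_mem hd₁)) d₂⁻¹ (commutator_le_self _ (inv_mem hd₂))
      rw [mul_inv_rev, h]
  -- (d) a central element of `[Ḡ₁, Ḡ₁]·[Ḡ₂, Ḡ₂]` has trivial factors
  intro y hy hyc
  have hπy : π y ∈ ⁅(Gamma B).map π, (Gamma B).map π⁆ := by
    rw [← Subgroup.map_commutator]
    have h3 : y ∈ ⁅Gamma B, Gamma B⁆ ⊔ K := hyc
    rw [Subgroup.mem_sup_of_normal_right] at h3
    obtain ⟨u, hu, v, hv, rfl⟩ := h3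
    exact ⟨u, hu, by rw [map_mul, hKer v hv, mul_one]⟩
  obtain ⟨d₁, hd₁, d₂, hd₂, hsum⟩ := hsplit _ hπy
  -- representatives
  have hd₁' : d₁ ∈ (⁅Gamma (B * A₁), Gamma (B * A₁)⁆).map π := by rwa [Subgroup.map_commutator]
  have hd₂' : d₂ ∈ (⁅Gamma (B * A₂), Gamma (B * A₂)⁆).map π := by rwa [Subgroup.map_commutator]
  obtain ⟨γ₁, hγ₁, rfl⟩ := hd₁'
  obtain ⟨γ₂, hγ₂, rfl⟩ := hd₂'
  have hγ₁B : γ₁ ∈ Gamma (B * A₁) := commutator_le_self _ hγ₁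
  have hγ₂B : γ₂ ∈ Gamma (B * A₂) := commutator_le_self _ hγ₂
  -- `γ₁ γ₂ ∈ y K ⊆ Γ(N)`
  have hprod : γ₁ * γ₂ ∈ Gamma (B * A₁ * A₂) := by
    rw [← map_mul, hπ, QuotientGroup.mk'_eq_mk'] at hsum
    obtain ⟨k, hk, hke⟩ := hsum
    rw [← hke]
    exact mul_mem hy (ker_map_subtype_le θ hk)
  have hγ₁N : γ₁ ∈ Gamma (B * A₁ * A₂) := by
    refine hinter γ₁ hγ₁B ?_
    have : γ₁ = (γ₁ * γ₂) * γ₂⁻¹ := by group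
    rw [this]
    exact mul_mem (hN₂ hprod) (inv_mem hγ₂B)
  have hγ₂N : γ₂ ∈ Gamma (B * A₁ * A₂) := by
    refine hinter γ₂ ?_ hγ₂B
    have : γ₂ = γ₁⁻¹ * (γ₁ * γ₂) := by group
    rw [this]
    exact mul_mem (inv_mem hγ₁B) (hN₁ hprod)
  have h1 : θ ⟨γ₁, hγ₁N⟩ = 1 := loc₁ γ₁ hγ₁N (Subgroup.mem_sup_left hγ₁)
  have h2 : θ ⟨γ₂, hγ₂N⟩ = 1 := loc₂ γ₂ hγ₂N (Subgroup.mem_sup_left hγ₂)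
  have hk₁ : π γ₁ = 1 := hKer γ₁ ((mem_ker_map_subtype_iff θ).mpr ⟨hγ₁N, h1⟩)
  have hk₂ : π γ₂ = 1 := hKer γ₂ ((mem_ker_map_subtype_iff θ).mpr ⟨hγ₂N, h2⟩)
  rw [hk₁, hk₂, mul_one] at hsum
  have hyK : y ∈ K := by
    rw [← QuotientGroup.ker_mk' K, MonoidHom.mem_ker, ← hπ]; exact hsum
  obtain ⟨_, h⟩ := (mem_ker_map_subtype_iff θ).mp hyK
  exact h

end UnboundedDenominators

end Literature.NumberTheory.Automorphic
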